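/-
Copyright (c) 2026. All rights reserved.
Released under Apache 2.0 license as described in the file LICENSE.
Authors: abc-iut cell, statement-typer seat abc-iut-L4-t3 (wave 1).
-/
import Literature.AnabelianGeometry.AbsoluteAnabelian.LogFrobeniusPanalocalizationTelecoreProofs
import HarnessLib

/-!
# [AbsTopIII] Corollary 5.5 (vi), telecore clause: the coherence datum from three print-quoting coherences

S. Mochizuki, *Topics in absolute anabelian geometry III: global reconstruction algorithms*,
J. Math. Sci. Univ. Tokyo 22 (2015) 939–1156 [MochizukiAbsTopIII2015]; Cor 5.5 (ii) p. 130–131, (vi) p. 132,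
Def 5.1 (iv)/(vi) p. 116–118, Def 5.4 (ii) p. 125, Rmk 3.5.1 p. 78.

`LogFrobeniusPanalocalizationTelecoreProofs.lean` (this seat) proves the telecore clause of Cor 5.5 (vi),
`Cor55PanalocalizationTelecore P`, for every panalocalization `P : D⊚⊢ → D✠⊢` equipped with the coherence DATUM
`P.TelecoreOverHom` ("`Ψ_P` lies over `Φ_𝒳 : Th⊚_T[Z] → Th✠_T[Z]`": vertex comparisons `θ_v` and one prism per arrow of
`D_{An•}`).  Here the datum is CONSTRUCTED from the 2-cells of `P` itself — `θ_v` is the pasting of `P`'s 2-cells down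
the column `v → ⋯ → ℰ• → An•[𝒳] → 𝒳` of structure functors (`thetaApp`) — and the prisms are PROVED at every arrow of
`D_{An•}` from three print-quoting coherence conditions on `P`, all three equalities of 2-cells between `P`'s data and
the data of the two settings:

* `P.CompatibleWithTelecoreData` (ALREADY TYPED, `LogFrobeniusPanalocalization.lean`, a conjunct of
  `Cor55Panalocalization P`): "compatible with the telecore and contact structures of (ii)" — `η_{An⊚}` is carried to
  `η_{An✠}`;
* `P.OverLog` (NEW): `Φ_𝒳` carries the isomorphism "`log` is isomorphic to the identity functor" (Def 5.4 (ii) /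
  Cor 5.5 (ii): the arrows `log` of `D•` lie over `𝒳`) of `⊚` to that of `✠`;
* `P.OverLam v ν` (NEW): `Φ` carries "`λ⊞_{v,ν}` lies over `Th⊚[Z]`" to "`λ⊞_{v,ν}` lies over `Th✠[Z]`", modulo its own
  2-cell "`Th⊚_T → Th✠_T` lying over `Th⊚ → Th✠`" (Def 5.1 (vi)).

Main results: `overHomOfCoherence : P.CompatibleWithTelecoreData → P.OverLog → (∀ v ν, P.OverLam v ν) →
P.TelecoreOverHom` and hence `cor55PanalocalizationTelecore_of_coherence` (for `V(F_mod) ≠ ∅`); non-vacuity (the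
identity panalocalization `Panalocalization.identity L` satisfies all three) is the companion file
`LogFrobeniusPanalocalizationCoherenceIdentity.lean`.  HONEST LABEL: the three conditions are hypotheses ON `P` (the interface `Panalocalization` records
2-cells but no equations between them); nothing here bears on [IUTchIII] Cor. 3.12; typed ≠ proved.
-/

set_option autoImplicit false

noncomputable section

universe u

open CategoryTheory Quiver

namespace Literature.AnabelianGeometry.AbsoluteAnabelian

namespace Panalocalization

open DiagramOfCategories LogFrobeniusSetting

/-! ## Pasting squares of functors -/

section Paste

variable {A₁ A₂ B₁ B₂ C₁ C₂ : Type (u + 1)} [Category.{u} A₁] [Category.{u} A₂] [Category.{u} B₁] [Category.{u} B₂]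
  [Category.{u} C₁] [Category.{u} C₂] {Φa : A₁ ⥤ A₂} {Φb : B₁ ⥤ B₂} {Φc : C₁ ⥤ C₂} {G₁ : A₁ ⥤ B₁} {G₂ : A₂ ⥤ B₂}
  {H₁ : B₁ ⥤ C₁} {H₂ : B₂ ⥤ C₂}

/-- gluing two commuting squares along a functor, as abstract category algebra over variable objects. [folklore] -/
private theorem squarePaste_nat_calc {B₂' C₂' : Type (u + 1)} [Category.{u} B₂'] [Category.{u} C₂'] (H : B₂' ⥤ C₂')
    {X Y Z W : B₂'} (g : X ⟶ Y) (ay : Y ⟶ Z) (ax : X ⟶ W) (b : W ⟶ Z) (h₁ : g ≫ ay = ax ≫ b) {T U : C₂'}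
    (βy : H.obj Z ⟶ T) (βx : H.obj W ⟶ U) (c : U ⟶ T) (h₂ : H.map b ≫ βy = βx ≫ c) :
    H.map g ≫ H.map ay ≫ βy = (H.map ax ≫ βx) ≫ c := by
  rw [← H.map_comp_assoc, h₁, H.map_comp_assoc, h₂, Category.assoc]

/-- pasting of two squares of functors commuting up to isomorphism along their common vertical edge:
from `Φa ⋙ G₂ ≅ G₁ ⋙ Φb` and `Φb ⋙ H₂ ≅ H₁ ⋙ Φc` to `Φa ⋙ (G₂ ⋙ H₂) ≅ (G₁ ⋙ H₁) ⋙ Φc` (components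
`H₂(α_x) ≫ β_{G₁ x}`). [folklore] -/
def squarePaste (α : Φa ⋙ G₂ ≅ G₁ ⋙ Φb) (β : Φb ⋙ H₂ ≅ H₁ ⋙ Φc) : Φa ⋙ (G₂ ⋙ H₂) ≅ (G₁ ⋙ H₁) ⋙ Φc :=
  NatIso.ofComponents (fun x => H₂.mapIso (α.app x) ≪≫ β.app (G₁.obj x)) (fun {x y} f =>
    squarePaste_nat_calc H₂ (G₂.map (Φa.map f)) (α.hom.app y) (α.hom.app x) (Φb.map (G₁.map f)) (α.hom.naturality f)
      (β.hom.app (G₁.obj y)) (β.hom.app (G₁.obj x)) (Φc.map (H₁.map (G₁.map f))) (β.hom.naturality (G₁.map f)))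

/-- components of a pasted square. [folklore] -/
@[simp] private theorem squarePaste_hom_app (α : Φa ⋙ G₂ ≅ G₁ ⋙ Φb) (β : Φb ⋙ H₂ ≅ H₁ ⋙ Φc) (x : A₁) :
    (squarePaste α β).hom.app x = H₂.map (α.hom.app x) ≫ β.hom.app (G₁.obj x) := rfl

end Paste

variable {Vmod : Type u} {isArc : Vmod → Bool} {L₁ L₂ : LogFrobeniusSetting Vmod isArc} (P : Panalocalization L₁ L₂)

/-! ## The three coherence conditions -/

/-- **`Φ_𝒳` lies over `𝒳` along `log`**: the 2-cell of `P` at the arrows `log` followed by "`log⊚` is isomorphic to the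
identity functor" is "`log✠` is isomorphic to the identity functor" at `Φ_𝒳` (an equality of 2-cells
`Φ_𝒳 ⋙ log✠ ⟹ Φ_𝒳`). [cite: MochizukiAbsTopIII2015, Cor 5.5 (ii) p. 130] -/
def OverLog : Prop :=
  ∀ x : L₁.X, P.isoLog.hom.app x ≫ P.panT.map (L₁.logIsoId.hom.app x) = L₂.logIsoId.hom.app (P.panT.obj x)

/-- **`Φ` lies over "`λ⊞_{v,ν}` lies over `Th•[Z]`"**: pasting `P`'s 2-cells at `λ⊞_{v,ν} : □ → 𝒩⊞_v`, `𝒩⊞_v → 𝒩_v`,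
`𝒩_v → ℰ•` with "`λ⊞_{v,ν}` lies over `Th⊚[Z]`" gives "`λ⊞_{v,ν}` lies over `Th✠[Z]`" followed by the 2-cell
"`Th⊚_T[Z] → Th✠_T[Z]` lying over `Th⊚[Z] → Th✠[Z]`" (an equality of 2-cells `Φ_𝒳 ⋙ λ⊞ ⋙ (𝒩⊞_v → ℰ✠) ⟹ (𝒳⊚ → ℰ⊚) ⋙ Φ_ℰ`).
[cite: MochizukiAbsTopIII2015, Def 5.1 (vi) p. 118] -/
def OverLam (v : Vmod) (ν : LogVertex (isArc v)) : Prop :=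
  ∀ x : L₁.X,
    (L₂.toE v).map ((L₂.forget v).map ((P.isoLam v ν).hom.app x)) ≫
        (L₂.toE v).map ((P.isoForget v).hom.app ((L₁.lam v ν).obj x)) ≫
          (P.isoToE v).hom.app ((L₁.forget v).obj ((L₁.lam v ν).obj x)) ≫ P.pan.map ((L₁.lamOver v ν).hom.app x) =
      (L₂.lamOver v ν).hom.app (P.panT.obj x) ≫ P.over.hom.app x

/-! ## The vertex comparisons `θ_v`, pasted from `P`'s 2-cells -/

/-- `An•[𝒳]` and the `ℰ•` of row 7 are not in `D•_{≤5}`. [cite: MochizukiAbsTopIII2015, Cor 5.5 p. 130] -/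
theorem not_inFive_an : ¬ InFive (isArc := isArc) .an := fun h => absurd h.2 (by simp [DVertex.row])

/-- idem for row 7. [cite: MochizukiAbsTopIII2015, Cor 5.5 p. 130] -/
theorem not_inFive_e7 : ¬ InFive (isArc := isArc) .e7 := fun h => absurd h.2 (by simp [DVertex.row])

/-- **`θ_v : Ψ_v ⋙ N✠_v ≅ N⊚_v ⋙ Φ_𝒳`** at every vertex of `D_{An•}`: unitors at `𝒳_⋎`, `□` (structure functor the
identity), `isoφAn` at `An•[𝒳]`, and down the column `𝒩⊞_v → 𝒩_v → ℰ• → An•[𝒳] → 𝒳` the pasting of `P`'s 2-cells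
`isoForget`, `isoToE`, `isoκAn`, `isoφAn`. [cite: MochizukiAbsTopIII2015, Def 5.1 (vi) p. 118] -/
def thetaApp : ∀ w : (anTelecoreShape (Vmod := Vmod) (isArc := isArc) anTelJ).Vertex,
    P.telecoreHom.app w ⋙ (L₂.contactOver).N w ≅ (L₁.contactOver).N w ⋙ P.panT
  | ExtVertex.obs => P.isoφAn
  | ExtVertex.base ⟨.row1 _, _⟩ => P.panT.rightUnitor ≪≫ P.panT.leftUnitor.symm
  | ExtVertex.base ⟨.core, _⟩ => P.panT.rightUnitor ≪≫ P.panT.leftUnitor.symm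
  | ExtVertex.base ⟨.nplus v, _⟩ =>
    squarePaste (squarePaste (P.isoForget v) (P.isoToE v)) (squarePaste P.isoκAn P.isoφAn)
  | ExtVertex.base ⟨.nv v, _⟩ => squarePaste (P.isoToE v) (squarePaste P.isoκAn P.isoφAn)
  | ExtVertex.base ⟨.e5, _⟩ => squarePaste P.isoκAn P.isoφAn
  | ExtVertex.base ⟨.an, h⟩ => (not_inFive_an h).elim
  | ExtVertex.base ⟨.e7, h⟩ => (not_inFive_e7 h).elim
  | ExtVertex.base ⟨.nmonoPlus _, h⟩ => False.elim h.1
  | ExtVertex.base ⟨.nmono _, h⟩ => False.elim h.1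
  | ExtVertex.base ⟨.emono5, h⟩ => False.elim h.1
  | ExtVertex.base ⟨.anMono, h⟩ => False.elim h.1
  | ExtVertex.base ⟨.emono7, h⟩ => False.elim h.1

/-! ## The prisms -/

section Prisms

/-- the prism at `λ⊞_{v,ν}`, as abstract category algebra over variable objects and morphisms: from the `ℰ`-level
coherence `hE` (`OverLam`), the naturality squares `nκ`, `nφ` of (the relevant components `iκ_`, `iφ_` of) `isoκAn`,
`isoφAn`, and the `η`-compatibility `hη` (`CompatibleWithTelecoreData`). [folklore] -/
private theorem lam_prism_calc {X₁ X₂ E₁ E₂ A₁ A₂ : Type (u + 1)} [Category.{u} X₁] [Category.{u} X₂] [Category.{u} E₁]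
    [Category.{u} E₂] [Category.{u} A₁] [Category.{u} A₂] (T : X₁ ⥤ X₂) (Q : E₁ ⥤ E₂) (R : A₁ ⥤ A₂)
    (κ₁ : E₁ ⥤ A₁) (κ₂ : E₂ ⥤ A₂) (φ₁ : A₁ ⥤ X₁) (φ₂ : A₂ ⥤ X₂)
    {y₀ y₁ y₂ q : E₂} {z p : E₁} {x : X₁} (a₁ : y₀ ⟶ y₁) (a₂ : y₁ ⟶ y₂) (a₃ : y₂ ⟶ Q.obj z) (f : z ⟶ p)
    (l : y₀ ⟶ q) (oh : q ⟶ Q.obj p) (oi : Q.obj p ⟶ q) (η₁ : φ₁.obj (κ₁.obj p) ⟶ x)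
    (η₂ : φ₂.obj (κ₂.obj q) ⟶ T.obj x)
    (iκz : κ₂.obj (Q.obj z) ⟶ R.obj (κ₁.obj z)) (iκp : κ₂.obj (Q.obj p) ⟶ R.obj (κ₁.obj p))
    (iκp' : R.obj (κ₁.obj p) ⟶ κ₂.obj (Q.obj p))
    (iφz : φ₂.obj (R.obj (κ₁.obj z)) ⟶ T.obj (φ₁.obj (κ₁.obj z)))
    (iφp : φ₂.obj (R.obj (κ₁.obj p)) ⟶ T.obj (φ₁.obj (κ₁.obj p)))
    (iφp' : T.obj (φ₁.obj (κ₁.obj p)) ⟶ φ₂.obj (R.obj (κ₁.obj p)))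
    (nκ : κ₂.map (Q.map f) ≫ iκp = iκz ≫ R.map (κ₁.map f)) (hκ : iκp ≫ iκp' = 𝟙 _)
    (nφ : φ₂.map (R.map (κ₁.map f)) ≫ iφp = iφz ≫ T.map (φ₁.map (κ₁.map f))) (hφ : iφp ≫ iφp' = 𝟙 _)
    (hE : a₁ ≫ a₂ ≫ a₃ ≫ Q.map f = l ≫ oh) (ho : oh ≫ oi = 𝟙 q)
    (hη : T.map η₁ = iφp' ≫ φ₂.map iκp' ≫ φ₂.map (κ₂.map oi) ≫ η₂) :
    φ₂.map (κ₂.map a₁) ≫ φ₂.map (κ₂.map a₂) ≫ φ₂.map (κ₂.map a₃) ≫ φ₂.map iκz ≫ iφz ≫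
        T.map (φ₁.map (κ₁.map f)) ≫ T.map η₁ =
      φ₂.map (κ₂.map l) ≫ η₂ := by
  have hl : a₁ ≫ a₂ ≫ a₃ ≫ Q.map f ≫ oi = l := by
    have h := (reassoc_of% hE) oi
    rwa [ho, Category.comp_id] at h
  rw [hη, ← reassoc_of% nφ, reassoc_of% hφ, ← φ₂.map_comp_assoc iκz, ← nκ, φ₂.map_comp_assoc,
    ← φ₂.map_comp_assoc iκp, hκ, φ₂.map_id, Category.id_comp, ← hl]
  simp only [Functor.map_comp, Category.assoc]

variable {P}

/-- the component form of `CompatibleWithTelecoreData`. [folklore] -/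
private theorem compatibleWithTelecoreData_app (hT : P.CompatibleWithTelecoreData) (x : L₁.X) :
    P.panT.map (L₁.ηAn.hom.app x) =
      P.isoφAn.inv.app (L₁.κAn.functor.obj (L₁.proj.obj x)) ≫ L₂.φAn.map (P.isoκAn.inv.app (L₁.proj.obj x)) ≫
        L₂.φAn.map (L₂.κAn.functor.map (P.over.inv.app x)) ≫ L₂.ηAn.hom.app (P.panT.obj x) := by
  have h := NatTrans.congr_app hT x
  simp only [NatTrans.comp_app, Functor.whiskerRight_app, Functor.leftUnitor_hom_app, telecoreComparison,
    Iso.trans_hom, Iso.symm_hom, Functor.isoWhiskerLeft_hom, Functor.isoWhiskerRight_hom, Functor.associator_hom_app,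
    Functor.associator_inv_app, Functor.whiskerLeft_app, Functor.map_comp, Functor.rightUnitor_hom_app,
    Category.assoc] at h
  repeat (first
    | erw [Category.id_comp] at h
    | erw [Category.comp_id] at h
    | erw [L₂.φAn.map_id] at h
    | erw [L₂.κAn.functor.map_id] at h)
  repeat erw [Category.assoc] at h
  exact h

/-- the prism at `log`. [folklore] -/
private theorem prism_log (hlog : P.OverLog) (x : L₁.X) :
    (𝟭 L₂.X).map (P.isoLog.hom.app x) ≫ (P.panT.rightUnitor ≪≫ P.panT.leftUnitor.symm).hom.app (L₁.log.obj x) ≫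
        P.panT.map ((L₁.log.rightUnitor ≪≫ L₁.logIsoId).hom.app x) =
      (L₂.log.rightUnitor ≪≫ L₂.logIsoId).hom.app (P.panT.obj x) ≫
        (P.panT.rightUnitor ≪≫ P.panT.leftUnitor.symm).hom.app x := by
  simp only [Functor.id_map, Iso.trans_hom, Iso.symm_hom, NatTrans.comp_app, Functor.rightUnitor_hom_app,
    Functor.leftUnitor_inv_app]
  repeat (first | erw [Category.id_comp] | erw [Category.comp_id] | erw [Functor.map_id])
  exact hlog x

variable (P)

/-- the prism at `id_⋎`. [folklore] -/
private theorem prism_toCore (x : L₁.X) :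
    (𝟭 L₂.X).map ((P.panT.rightUnitor ≪≫ P.panT.leftUnitor.symm).hom.app x) ≫
        (P.panT.rightUnitor ≪≫ P.panT.leftUnitor.symm).hom.app ((𝟭 L₁.X).obj x) ≫
          P.panT.map ((𝟭 L₁.X).leftUnitor.hom.app x) =
      ((𝟭 L₂.X).leftUnitor).hom.app (P.panT.obj x) ≫ (P.panT.rightUnitor ≪≫ P.panT.leftUnitor.symm).hom.app x := by
  simp only [Functor.id_map, Iso.trans_hom, Iso.symm_hom, NatTrans.comp_app, Functor.rightUnitor_hom_app,
    Functor.leftUnitor_inv_app, Functor.leftUnitor_hom_app]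
  repeat (first | erw [Category.id_comp] | erw [Category.comp_id] | erw [P.panT.map_id])
  rfl

variable {P}

/-- the prism at `λ⊞_{v,ν}`. [folklore] -/
private theorem prism_lam (hT : P.CompatibleWithTelecoreData) (hlam : ∀ v ν, P.OverLam v ν) (v : Vmod)
    (ν : LogVertex (isArc v)) (x : L₁.X) :
    ((L₂.forget v ⋙ L₂.toE v) ⋙ (L₂.κAn.functor ⋙ L₂.φAn)).map ((P.isoLam v ν).hom.app x) ≫
        (squarePaste (squarePaste (P.isoForget v) (P.isoToE v)) (squarePaste P.isoκAn P.isoφAn)).hom.app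
            ((L₁.lam v ν).obj x) ≫
          P.panT.map (((Functor.associator _ _ _).symm ≪≫
            Functor.isoWhiskerRight (L₁.lamOver v ν) (L₁.κAn.functor ⋙ L₁.φAn) ≪≫ L₁.ηAn).hom.app x) =
      ((Functor.associator _ _ _).symm ≪≫
          Functor.isoWhiskerRight (L₂.lamOver v ν) (L₂.κAn.functor ⋙ L₂.φAn) ≪≫ L₂.ηAn).hom.app (P.panT.obj x) ≫
        (P.panT.rightUnitor ≪≫ P.panT.leftUnitor.symm).hom.app x := by
  have h := lam_prism_calc P.panT P.pan P.panAn L₁.κAn.functor L₂.κAn.functor L₁.φAn L₂.φAn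
    ((L₂.toE v).map ((L₂.forget v).map ((P.isoLam v ν).hom.app x)))
    ((L₂.toE v).map ((P.isoForget v).hom.app ((L₁.lam v ν).obj x)))
    ((P.isoToE v).hom.app ((L₁.forget v).obj ((L₁.lam v ν).obj x))) ((L₁.lamOver v ν).hom.app x)
    ((L₂.lamOver v ν).hom.app (P.panT.obj x)) (P.over.hom.app x) (P.over.inv.app x) (L₁.ηAn.hom.app x)
    (L₂.ηAn.hom.app (P.panT.obj x))
    (P.isoκAn.hom.app _) (P.isoκAn.hom.app _) (P.isoκAn.inv.app _) (P.isoφAn.hom.app _) (P.isoφAn.hom.app _)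
    (P.isoφAn.inv.app _) (P.isoκAn.hom.naturality _) (P.isoκAn.hom_inv_id_app _) (P.isoφAn.hom.naturality _)
    (P.isoφAn.hom_inv_id_app _) (hlam v ν x) (P.over.hom_inv_id_app x) (compatibleWithTelecoreData_app hT x)
  simp only [Functor.comp_map, Iso.trans_hom, Iso.symm_hom, NatTrans.comp_app, Functor.associator_inv_app,
    Functor.isoWhiskerRight_hom, Functor.whiskerRight_app, squarePaste_hom_app, Functor.rightUnitor_hom_app,
    Functor.leftUnitor_inv_app]
  repeat (first | erw [Category.id_comp] | erw [Category.comp_id] | erw [P.panT.map_id])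
  repeat (first | erw [L₂.κAn.functor.map_comp] | erw [L₂.φAn.map_comp] | erw [P.panT.map_comp])
  repeat erw [Category.assoc]
  exact h

variable (P)

/-- the prism at `𝒩⊞_v → 𝒩_v`. [folklore] -/
private theorem prism_forget (v : Vmod) (x : L₁.Nplus v) :
    (L₂.toE v ⋙ (L₂.κAn.functor ⋙ L₂.φAn)).map ((P.isoForget v).hom.app x) ≫
        (squarePaste (P.isoToE v) (squarePaste P.isoκAn P.isoφAn)).hom.app ((L₁.forget v).obj x) ≫
          P.panT.map (((Functor.associator (L₁.forget v) (L₁.toE v) (L₁.κAn.functor ⋙ L₁.φAn)).symm).hom.app x) =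
      ((Functor.associator (L₂.forget v) (L₂.toE v) (L₂.κAn.functor ⋙ L₂.φAn)).symm).hom.app
          ((P.panNplus v).obj x) ≫
        (squarePaste (squarePaste (P.isoForget v) (P.isoToE v)) (squarePaste P.isoκAn P.isoφAn)).hom.app x := by
  simp only [Functor.comp_map, Iso.symm_hom, Functor.associator_inv_app, squarePaste_hom_app]
  repeat (first | erw [Category.id_comp] | erw [Category.comp_id] | erw [P.panT.map_id])
  repeat (first | erw [L₂.κAn.functor.map_comp] | erw [L₂.φAn.map_comp])
  repeat erw [Category.assoc]
  rfl

/-- the prism at `𝒩_v → ℰ•`. [folklore] -/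
private theorem prism_toE (v : Vmod) (x : L₁.N v) :
    (L₂.κAn.functor ⋙ L₂.φAn).map ((P.isoToE v).hom.app x) ≫
        (squarePaste P.isoκAn P.isoφAn).hom.app ((L₁.toE v).obj x) ≫
          P.panT.map ((Iso.refl (L₁.toE v ⋙ L₁.κAn.functor ⋙ L₁.φAn)).hom.app x) =
      (Iso.refl (L₂.toE v ⋙ L₂.κAn.functor ⋙ L₂.φAn)).hom.app ((P.panN v).obj x) ≫
        (squarePaste (P.isoToE v) (squarePaste P.isoκAn P.isoφAn)).hom.app x := by
  simp only [Functor.comp_map, Iso.refl_hom, NatTrans.id_app, squarePaste_hom_app]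
  repeat (first | erw [Category.id_comp] | erw [Category.comp_id] | erw [P.panT.map_id])
  rfl

/-- the prism at the observation edge `κ_{An•} : ℰ• → An•[𝒳]`. [folklore] -/
private theorem prism_obs (x : L₁.E) :
    L₂.φAn.map (P.isoκAn.hom.app x) ≫ P.isoφAn.hom.app (L₁.κAn.functor.obj x) ≫
        P.panT.map ((Iso.refl (L₁.κAn.functor ⋙ L₁.φAn)).hom.app x) =
      (Iso.refl (L₂.κAn.functor ⋙ L₂.φAn)).hom.app (P.pan.obj x) ≫ (squarePaste P.isoκAn P.isoφAn).hom.app x := by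
  simp only [Iso.refl_hom, NatTrans.id_app, squarePaste_hom_app]
  repeat (first | erw [Category.id_comp] | erw [Category.comp_id] | erw [P.panT.map_id])
  rfl

/-- the prism at the telecore edges `φ_⋏ : An•[𝒳] → 𝒳_⋏`. [folklore] -/
private theorem prism_tel (x : L₁.An) :
    (𝟭 L₂.X).map (P.isoφAn.hom.app x) ≫ (P.panT.rightUnitor ≪≫ P.panT.leftUnitor.symm).hom.app (L₁.φAn.obj x) ≫
        P.panT.map (L₁.φAn.rightUnitor.hom.app x) =
      L₂.φAn.rightUnitor.hom.app (P.panAn.obj x) ≫ P.isoφAn.hom.app x := by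
  simp only [Functor.id_map, Iso.trans_hom, Iso.symm_hom, NatTrans.comp_app, Functor.rightUnitor_hom_app,
    Functor.leftUnitor_inv_app]
  repeat (first | erw [Category.id_comp] | erw [Category.comp_id] | erw [P.panT.map_id])

end Prisms

/-- **the coherence datum from the three coherences**: `Ψ_P` lies over `Φ_𝒳` with `θ_v` the pasted 2-cells of `P`,
the prisms at `log` being `OverLog`, at `λ⊞_{v,ν}` being `OverLam` whiskered with `κ_{An•} ⋙ φ_{An•}` followed by the
`η`-compatibility `CompatibleWithTelecoreData` (and the naturality of `isoκAn`, `isoφAn`), and at every other arrow of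
`D_{An•}` (`id_⋎`, `𝒩⊞_v → 𝒩_v → ℰ• → An•[𝒳]`, the telecore edges `φ_⋏`) automatic.
[cite: MochizukiAbsTopIII2015, Cor 5.5 (vi) p. 132] -/
def overHomOfCoherence (hT : P.CompatibleWithTelecoreData) (hlog : P.OverLog) (hlam : ∀ v ν, P.OverLam v ν) :
    P.TelecoreOverHom where
  θ := P.thetaApp
  prism := by
    rintro (⟨a, ha⟩ | _) (⟨b, hb⟩ | _) e x
    · -- an arrow of `D•_{≤5}`
      cases e with
      | log n => exact prism_log hlog x
      | toCore n => exact prism_toCore P x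
      | lam v ν hν => exact prism_lam hT hlam v ν x
      | forget v => exact prism_forget P v x
      | toE v => exact prism_toE P v x
      | κAn => exact (not_inFive_an hb).elim
      | anToE => exact (not_inFive_an ha).elim
      | monoNplus _ => exact False.elim hb.1
      | monoN _ => exact False.elim hb.1
      | monoE5 => exact False.elim hb.1
      | monoAn => exact False.elim hb.1
      | monoE7 => exact False.elim hb.1
      | forgetMono _ => exact False.elim hb.1
      | toEmono _ => exact False.elim hb.1
      | κAnMono => exact False.elim hb.1
      | anMonoToE => exact False.elim hb.1
    · -- the observation edge `κ_{An•} : ℰ• → An•[𝒳]`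
      cases e
      exact prism_obs P x
    · -- the telecore edges `φ_⋏ : An•[𝒳] → 𝒳_⋏`
      cases b <;> first | exact (PEmpty.elim e) | exact prism_tel P x
    · exact PEmpty.elim e

section Holds

variable [Nonempty Vmod]

/-- **Cor 5.5 (vi), telecore clause — PROVED from the three coherences**: a panalocalization compatible with the
telecore and contact structures of (ii) in the typed sense `CompatibleWithTelecoreData` and lying over `𝒳` along `log`
and `λ⊞_{v,ν}` (`OverLog`, `OverLam`) satisfies `Cor55PanalocalizationTelecore` (for `V(F_mod) ≠ ∅`).
[cite: MochizukiAbsTopIII2015, Cor 5.5 (vi) p. 132] -/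
theorem cor55PanalocalizationTelecore_of_coherence (hT : P.CompatibleWithTelecoreData) (hlog : P.OverLog)
    (hlam : ∀ v ν, P.OverLam v ν) : P.Cor55PanalocalizationTelecore :=
  P.cor55PanalocalizationTelecore_of_overHom (P.overHomOfCoherence hT hlog hlam)

/-- in particular from the typed Cor 5.5 (vi) assumption `Cor55Panalocalization P` together with `OverLog`, `OverLam`.
[cite: MochizukiAbsTopIII2015, Cor 5.5 (vi) p. 132] -/
theorem cor55PanalocalizationTelecore_of_cor55Panalocalization (h : P.Cor55Panalocalization) (hlog : P.OverLog)
    (hlam : ∀ v ν, P.OverLam v ν) : P.Cor55PanalocalizationTelecore :=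
  P.cor55PanalocalizationTelecore_of_coherence h.2.1 hlog hlam

end Holds

end Panalocalization

end Literature.AnabelianGeometry.AbsoluteAnabelian

end
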